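/-
Copyright (c) 2026 the pub-hodgecm-mathlib formalisation cell (harness21).  Prover seat hodgecm-mathlib-F0P3a-p08 (g19), 2026-09-02.  Road «S3-tree»∕«S3-ram» (LEAD F0P3a-plan (g12);
owner p06 (g15)), (Cnt2′) organ card (chair F0P3a-p07 (g14) 01:05:20Z): ROW SOCKET `T2G_bd` — the `bd` stratum of the fixed cosets of ONE deep type-(2) literal at a tamely
RAMIFIED CM place, in the coset currency, keyed on the literal-independent norm class `c(γ_H)` (ramified twin of ★ inert `DepthZeroKappaTransferTypeTwoRowTwo` Steps 1–2).
-/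
import Literature.NumberTheory.Rogawski1990.DepthZeroKappaTransferTypeTwoRamifiedRowTwoPlaceLaw   -- ★ p847494 (this seat) FILE 2c: `ncard_selfDual_cyclic_typeTwo_ram_eq_of_norm`
import Literature.NumberTheory.Rogawski1990.TypeTwoOnePlaceDataNonsplit                        -- (this seat) (D1)′: `exists_typeTwo_onePlace_data_nonsplit_discFree`
import Literature.NumberTheory.Automorphic.UnitaryDepthZeroPieceOrbitalIntegral                  -- ★ transport `ncard_fixedBy_rankStratum_eq_ncard_localNonsplitEquiv`
import Literature.NumberTheory.Automorphic.DeepElementCyclicLatticeStable                        -- ★ rider `ncard_fixedBy_unitary_rank_eq_ncard_free'` (place-generic)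
import Literature.NumberTheory.Rogawski1990.UnitFundamentalLemmaInertFlickerFrame                -- ★ `isUnit_two_integer_iff_valued_eq_one`
import Literature.NumberTheory.Rogawski1990.LocalIrreducibleTorusDiscriminantRamified            -- ★ F0P2-p02: `exists_valued_disc_eq_exp_neg_even_sqDist_of_not_exists_isRoot_ramified`
import Literature.NumberTheory.Rogawski1990.RamifiedPlaceNormSymbolDichotomy                     -- ★ `hilbertSymbol_eq_one_iff_exists_norm_toPlace`
import Literature.NumberTheory.QuadraticForms.QuadraticNormIndexLocal                            -- ★ `hilbertSymbol_mul_left` (index two)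
import Literature.NumberTheory.QuadraticForms.HilbertSymbolRegular                               -- ★ `hilbertSymbol_inv_left`
import Literature.NumberTheory.NumberFields.QuadraticUnramifiedAtUnitPlace                       -- ★ `two_not_mem_iff_valued_two_eq_one`
import HarnessLib

/-!
# The depth-zero κ-transfer, type (2), TAMELY RAMIFIED place: the `bd` stratum of one literal (row socket `T2G_bd`)

Topic `NumberTheory/Rogawski1990`; namespace `Literature.NumberTheory.Rogawski1990`.  THEOREMS ONLY (no definition, no instance, no notation, no named fact, no `sorry`); kernel lane
`--supports stmt-HodgeConjecture-24833`.  Road «S3-tree», seeding wave «S3-ram», (Cnt2′) «THE FIVE SIGNED STRATA COUNT LAWS OF TYPE (2), RAMIFIED», row `bd` (chair F0P3a-p07 (g14)).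
HONEST LABEL: HC_CM is proved only modulo the 2 remaining named inputs (hLiu418 24832, h413 24833) until rung 0 closes; unconditional local algebra, count-neutral.

THE MATHEMATICS (Rogawski §4.9, proof of Lemma 4.9.3; Kottwitz §3).  `γ_H` a type-(2) `G`-regular element at a non-split place `v` of `L⁺` RAMIFIED in the CM field `L`, `H′` hermitian
with `H′_w` unimodular at the place `w ∣ v`, `2 ∈ 𝒪_w^×`; `δ ∈ G′_v` a DEEP match of `γ_H` (`δ_w ≡ 1`).  The `bd` stratum of the `δ`-fixed cosets `q ∈ G′_v ⧸ K′_v` — those with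
`rank(red(q⁻¹δq)_w − 1) = 2` (regular nilpotent residual) — is in bijection with the self-dual `δ_w`-cyclic lattices (★ transport ∘ ★ rider, place-generic), whose number is ★ FILE 2c:
`2·q^{(N+n−1)∕2}` (`N` odd) ∕ `(q+1)·q^{(N+n−2)∕2}` (`N` even) if `d₀(δ)·c(γ_H)` is a `σ_w`-norm and `0` otherwise, where `ord_w(tr² − 4det) = 2N`, `n = ord_w χ_g(u_w) = 2m`,
`d₀(δ) = x₀*·H′_w·x₀` is the hermitian value on the rational `u`-eigenline of `δ_w` (★ (D1)′) and `c(γ_H) = det H′_w · χ_g(u_w) ∕ ((1 + u_w)²·χ_g(−1))` is LITERAL-INDEPENDENT.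
Since `κ_v(γ_H, δ) = 1 ⟺ d₀(δ)` is a norm (★ (D1)′ (26′)) and the norm group has index two (★ `hilbertSymbol_mul_left`), the favourable condition reads
**`κ_v(γ_H, δ) = 1 ⟺ c(γ_H) ∈ N(L_w^×)`** — so of the two matched literals `t₊` (`κ = 1`), `t₋` (`κ = −1`) exactly one carries the cyclic lattices.

* §1 **`exists_norm_mul_iff_of_ramified`** — for `σ_w`-fixed non-zero `a, b`: `(∃ z, z·σz·(a·b) = 1) ↔ ((∃ z ≠ 0, a = z·σz) ↔ ∃ z, z·σz·b = 1)` (Hilbert symbols, index two).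
* §2 **`ncard_rankStratum_two_typeTwo_ram_eq_ite`** — the row socket `T2G_bd`.

References: [Rogawski1990] J. D. Rogawski, *Automorphic Representations of Unitary Groups in Three Variables* (1990), §4.9 Lemma 4.9.3 p. 56, Prop. 4.9.1 (b) p. 55; [Kottwitz1986]
R. E. Kottwitz, *Base change for unit elements of Hecke algebras*, Compositio Math. 60 (1986), §3; [Omeara1963] O. T. O'Meara, *Introduction to Quadratic Forms* (1963), §63B.
-/

set_option autoImplicit false

noncomputable section

open NumberField IsDedekindDomain Matrix Polynomial Finset ValuativeRel
open scoped MatrixGroups WithZero ValuativeRel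

namespace Literature.NumberTheory.Rogawski1990

open Literature.NumberTheory.Automorphic Literature.NumberTheory.Automorphic.UnitaryGroup Literature.NumberTheory.GaloisRepresentations
open Literature.NumberTheory.NumberFields Literature.NumberTheory.LocalFields Literature.NumberTheory.QuadraticForms
open Literature.NumberTheory.Automorphic.IntegralReduction

variable (L : Type) [Field L] [NumberField L] [IsCMField L] {v : HeightOneSpectrum (𝓞 ↥(maximalRealSubfield L))}

/-! ## §1 Products of norm classes at a non-split place (index two) -/

/-- **INDEX TWO**: for `σ_w`-fixed non-zero `a, b ∈ L_w` at a non-split `w ∣ v ∤ 2`, `a·b` is a `σ_w`-norm iff (`a` is a norm ⟺ `b` is a norm) — read through the Hilbert symbols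
`(·, θ)_v` (★ `hilbertSymbol_eq_one_iff_exists_norm_toPlace`, ★ `hilbertSymbol_mul_left`). [cite: Omeara1963, §63B] -/
theorem exists_norm_mul_iff_of_nonsplit (w : PlacesOver L v) (hw : IsCMField.complexConj L • w.1 = w.1)
    (h2v : Valued.v (2 : v.adicCompletion ↥(maximalRealSubfield L)) = 1) {a b : w.1.adicCompletion L} (ha0 : a ≠ 0) (hb0 : b ≠ 0)
    (hσa : galAdicCompletionMap (L := L) (IsCMField.complexConj L) hw a = a) (hσb : galAdicCompletionMap (L := L) (IsCMField.complexConj L) hw b = b) :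
    (∃ z : w.1.adicCompletion L, z * galAdicCompletionMap (L := L) (IsCMField.complexConj L) hw z * (a * b) = 1) ↔
      ((∃ z : w.1.adicCompletion L, z ≠ 0 ∧ a = z * galAdicCompletionMap (L := L) (IsCMField.complexConj L) hw z) ↔
        ∃ z : w.1.adicCompletion L, z * galAdicCompletionMap (L := L) (IsCMField.complexConj L) hw z * b = 1) := by
  haveI : Algebra.IsQuadraticExtension ↥(maximalRealSubfield L) L := IsCMField.isQuadraticExtension L
  have hc1 : IsCMField.complexConj L ≠ 1 := IsCMField.complexConj_ne_one L
  set σ := galAdicCompletionMap (L := L) (IsCMField.complexConj L) hw with hσdef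
  set θ : v.adicCompletion ↥(maximalRealSubfield L) :=
    algebraMap ↥(maximalRealSubfield L) _ ((cmQuadraticGenerator L : 𝓞 ↥(maximalRealSubfield L)) : ↥(maximalRealSubfield L)) with hθdef
  have hθ0 : θ ≠ 0 := by
    rw [hθdef, Ne, map_eq_zero_iff _ (algebraMap ↥(maximalRealSubfield L) (v.adicCompletion ↥(maximalRealSubfield L))).injective]
    exact fun h => not_isSquare_cmQuadraticGenerator L (by rw [h]; exact IsSquare.zero)
  have h2O : (2 : 𝓞 ↥(maximalRealSubfield L)) ∉ v.asIdeal := (two_not_mem_iff_valued_two_eq_one v).2 h2v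
  -- descend the fixed elements
  obtain ⟨a₀, ha₀⟩ := exists_toPlace_eq_of_galAdicCompletionMap_eq (IsCMField.complexConj L) w hc1 hw a hσa
  obtain ⟨b₀, hb₀⟩ := exists_toPlace_eq_of_galAdicCompletionMap_eq (IsCMField.complexConj L) w hc1 hw b hσb
  have ha₀0 : a₀ ≠ 0 := fun h => ha0 (by rw [← ha₀, h, map_zero])
  have hb₀0 : b₀ ≠ 0 := fun h => hb0 (by rw [← hb₀, h, map_zero])
  -- the norm readings
  have hN : ∀ {y : v.adicCompletion ↥(maximalRealSubfield L)}, y ≠ 0 →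
      ((∃ z : w.1.adicCompletion L, σ z * z = toPlace v w y) ↔ hilbertSymbol (v.adicCompletion ↥(maximalRealSubfield L)) y θ = 1) :=
    fun {y} hy => (hilbertSymbol_eq_one_iff_exists_norm_toPlace L v w hw hy).symm
  have hinv : ∀ {x : v.adicCompletion ↥(maximalRealSubfield L)}, x ≠ 0 →
      ((∃ z : w.1.adicCompletion L, z * σ z * toPlace v w x = 1) ↔ ∃ z : w.1.adicCompletion L, σ z * z = toPlace v w x⁻¹) := by
    intro x hx
    have hx' : toPlace v w x ≠ 0 := (_root_.map_ne_zero _).2 hx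
    constructor
    · rintro ⟨z, hz⟩
      refine ⟨z, ?_⟩
      rw [map_inv₀]
      exact eq_inv_of_mul_eq_one_left (by linear_combination hz)
    · rintro ⟨z, hz⟩
      refine ⟨z, ?_⟩
      rw [map_inv₀] at hz
      calc z * σ z * toPlace v w x = (σ z * z) * toPlace v w x := by ring
        _ = 1 := by rw [hz, inv_mul_cancel₀ hx']
  have hA : (∃ z : w.1.adicCompletion L, z ≠ 0 ∧ a = z * σ z) ↔ hilbertSymbol (v.adicCompletion ↥(maximalRealSubfield L)) a₀ θ = 1 := by
    rw [← hN ha₀0]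
    constructor
    · rintro ⟨z, -, hz⟩
      exact ⟨z, by rw [ha₀, hz]; ring⟩
    · rintro ⟨z, hz⟩
      refine ⟨z, ?_, by rw [← ha₀, ← hz]; ring⟩
      rintro rfl
      rw [map_zero, zero_mul] at hz
      exact ha0 (by rw [← ha₀, ← hz])
  have hB : (∃ z : w.1.adicCompletion L, z * σ z * b = 1) ↔ hilbertSymbol (v.adicCompletion ↥(maximalRealSubfield L)) b₀ θ = 1 := by
    rw [← hb₀, hinv hb₀0, hN (inv_ne_zero hb₀0), hilbertSymbol_inv_left hb₀0]
  have hAB : (∃ z : w.1.adicCompletion L, z * σ z * (a * b) = 1) ↔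
      hilbertSymbol (v.adicCompletion ↥(maximalRealSubfield L)) a₀ θ * hilbertSymbol (v.adicCompletion ↥(maximalRealSubfield L)) b₀ θ = 1 := by
    rw [← ha₀, ← hb₀, ← map_mul, hinv (mul_ne_zero ha₀0 hb₀0), hN (inv_ne_zero (mul_ne_zero ha₀0 hb₀0)),
      hilbertSymbol_inv_left (mul_ne_zero ha₀0 hb₀0), hilbertSymbol_mul_left ↥(maximalRealSubfield L) v h2O ha₀0 hb₀0 hθ0]
  rw [hAB, hA, hB]
  rcases hilbertSymbol_eq_one_or_eq_neg_one a₀ θ with h1 | h1 <;>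
    rcases hilbertSymbol_eq_one_or_eq_neg_one b₀ θ with h3 | h3 <;> simp [h1, h3]

/-! ## §2 The row socket `T2G_bd` -/

set_option synthInstance.maxHeartbeats 200000 in
set_option maxHeartbeats 1600000 in
open scoped Classical in
/-- **ROW `bd` OF THE TYPE-(2) SIGNED STRATA COUNT AT A RAMIFIED PLACE (socket `T2G_bd`).**  For a type-(2) `G`-regular `γ_H` at a non-split `v ∤ 2` RAMIFIED in `L` with `H′_w`
unimodular at the CM place `w`, and a deep match `δ ∈ G′_v` (`IsLocalNormPair`, `charpoly δ_w ≡ (X − 1)³`): with `ord_w χ_g(u_w) = 2m` (token `|χ_g(u)|_w = |ι_w ϖ_v|^m`) and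
`ord_w(tr² − 4det) = 2N`, `1 ≤ N`, the `bd` stratum (residual `rank(red(q⁻¹δq)_w − 1) = 2`) of the `δ`-fixed cosets counts `2·q^{(N+2m−1)∕2}` (`N` odd) ∕ `(q+1)·q^{(N+2m−2)∕2}`
(`N` even) if `κ_v(γ_H, δ) = 1 ⟺ c(γ_H) ∈ N(L_w^×)`, and `0` otherwise, `c(γ_H) = det H′_w · χ_g(u_w) ∕ ((1 + u_w)²·(1 + tr g_w + det g_w))`.
★ transport ∘ ★ rider ∘ ★ (D1)′ ∘ ★ FILE 2c ∘ §1. [cite: Rogawski1990, §4.9 Lemma 4.9.3 p. 56, Prop. 4.9.1 (b) p. 55] [cite: Kottwitz1986, §3] -/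
theorem ncard_rankStratum_two_typeTwo_ram_eq_ite (H' : Matrix (Fin 3) (Fin 3) L)
    (hH' : (H'.map (IsCMField.complexConj L))ᵀ = H') (w : PlacesOver L v)
    (hw : IsCMField.complexConj L • w.1 = w.1) (he : v.asIdeal.ramificationIdx' w.1.asIdeal ≠ 1)
    (hH'w : IsUnit (placeForm H' w.1)) (hH'i : hH'w.unit ∈ glInt 3 (w.1.adicCompletion L))
    (h2 : IsUnit (2 : 𝒪[w.1.adicCompletion L]))
    {γH : ((cmDatum L 2 (Matrix.of fun i j : Fin 2 => if i.val + j.val + 1 = 2 then (1 : L) else 0)).Local v ×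
      (cmDatum L 1 (Matrix.of fun i j : Fin 1 => if i.val + j.val + 1 = 1 then (1 : L) else 0)).Local v)}
    (hreg : IsLocalGRegular L v γH)
    (hirr : ¬ ∃ x : w.1.adicCompletion L, (((γH.1.val : GL (Fin 2) (LocalRing L v)).val.map (Pi.evalRingHom (fun w' : PlacesOver L v => w'.1.adicCompletion L) w)).charpoly).IsRoot x)
    (m N : ℕ)
    (hm : Valued.v (((finCharpolyTwo L v γH).eval (finGammaTwo L v γH)) w) = Valued.v ((toPlace v w (HeckeCharacter.uniformizer ↥(maximalRealSubfield L) v : v.adicCompletion ↥(maximalRealSubfield L))) ^ m))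
    (hN : Valued.v (((γH.1.val : GL (Fin 2) (LocalRing L v)).val.map (Pi.evalRingHom (fun w' : PlacesOver L v => w'.1.adicCompletion L) w)).trace ^ 2 - 4 * ((γH.1.val : GL (Fin 2) (LocalRing L v)).val.map (Pi.evalRingHom (fun w' : PlacesOver L v => w'.1.adicCompletion L) w)).det) = WithZero.exp (-((2 * N : ℕ) : ℤ))) (hN1 : 1 ≤ N)
    {δ : (cmDatum L 3 H').Local v} (hδ : IsLocalNormPair L H' v γH δ)
    (ht : ∀ k : ℕ, ValuativeRel.valuation (w.1.adicCompletion L) ((((δ.val : GL (Fin 3) (LocalRing L v)).val.map (Pi.evalRingHom (fun w' : PlacesOver L v => w'.1.adicCompletion L) w)).charpoly - (Polynomial.X - 1) ^ 3).coeff k) < 1) :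
    {q : (cmDatum L 3 H').Local v ⧸ cmLocalIntegralLevel L 3 H' v |
        q ∈ MulAction.fixedBy ((cmDatum L 3 H').Local v ⧸ cmLocalIntegralLevel L 3 H' v) δ ∧
          (redMat ((((q.out⁻¹ * δ * q.out : (cmDatum L 3 H').Local v)).val : GL (Fin 3) (LocalRing L v)).val.map
            (Pi.evalRingHom (fun w' : UnitaryGroup.PlacesOver L v => w'.1.adicCompletion L) w)) - 1).rank = 2}.ncard =
      if (finKappaAt L v H' γH δ = 1 ↔
          ∃ z : w.1.adicCompletion L, z * galAdicCompletionMap (L := L) (IsCMField.complexConj L) hw z *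
            ((placeForm H' w.1).det * (((finCharpolyTwo L v γH).eval (finGammaTwo L v γH)) w) /
              ((1 + finGammaTwo L v γH w) ^ 2 * (1 + ((γH.1.val : GL (Fin 2) (LocalRing L v)).val.map (Pi.evalRingHom (fun w' : PlacesOver L v => w'.1.adicCompletion L) w)).trace + ((γH.1.val : GL (Fin 2) (LocalRing L v)).val.map (Pi.evalRingHom (fun w' : PlacesOver L v => w'.1.adicCompletion L) w)).det))) = 1) then
        (if Odd N then 2 * Ideal.absNorm v.asIdeal ^ ((N + 2 * m - 1) / 2) else (Ideal.absNorm v.asIdeal + 1) * Ideal.absNorm v.asIdeal ^ ((N + 2 * m - 2) / 2))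
      else 0 := by
  classical
  haveI : Algebra.IsQuadraticExtension ↥(maximalRealSubfield L) L := IsCMField.isQuadraticExtension L
  have hc1 : IsCMField.complexConj L ≠ 1 := IsCMField.complexConj_ne_one L
  set σ := galAdicCompletionMap (L := L) (IsCMField.complexConj L) hw with hσdef
  -- Step 1: the stratum as a count of self-dual `δ_w`-cyclic lattices (★ transport ∘ ★ rider, both place-generic)
  rw [ncard_fixedBy_rankStratum_eq_ncard_localNonsplitEquiv L 3 H' v w hw δ 2]
  have hrid := ncard_fixedBy_unitary_rank_eq_ncard_free' σ hH'w.unit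
    (localNonsplitEquiv (IsCMField.complexConj L) H' hc1 w hw δ) ht
  simp only [show (3 : ℕ) - 1 = 2 from rfl] at hrid
  refine hrid.trans ?_
  have hcoe : (((localNonsplitEquiv (IsCMField.complexConj L) H' hc1 w hw δ :
      ↥(unitaryGroupOfForm σ (placeForm H' w.1))) : GL (Fin 3) (w.1.adicCompletion L)) : Matrix (Fin 3) (Fin 3) (w.1.adicCompletion L)) =
      ((δ.val : GL (Fin 3) (LocalRing L v)).val.map (Pi.evalRingHom (fun w' : PlacesOver L v => w'.1.adicCompletion L) w)) := rfl
  simp only [hcoe]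
  -- Step 2: ★ (D1)′ the one-place data, with `n := 2m`
  have hP : Valued.v (toPlace v w (HeckeCharacter.uniformizer ↥(maximalRealSubfield L) v : v.adicCompletion ↥(maximalRealSubfield L))) = WithZero.exp (-2 : ℤ) :=
    (valued_toPlace_uniformizer_of_ramified L (IsCMField.complexConj L) hc1 w hw he).1
  have hn : Valued.v (((finCharpolyTwo L v γH).eval (finGammaTwo L v γH)) w) = WithZero.exp (-((2 * m : ℕ) : ℤ)) := by
    rw [hm, map_pow, hP, ← WithZero.exp_nsmul]
    congr 1; push_cast; ring
  obtain ⟨u, t, D, w₀, x₀, hu, htt, hDD, -, htO, hDO, hχ, -, -, -, hτU, hσu, hσD, hσt, hn', hu1, ht2, hχune, -, hK, hx₀0, hx₀, hS0, hσS, h26⟩ :=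
    exists_typeTwo_onePlace_data_nonsplit_discFree L H' hH' w hw hH'w hreg hirr (2 * m) hn hδ ht
  have hv2 : Valued.v (2 : w.1.adicCompletion L) = 1 := (isUnit_two_integer_iff_valued_eq_one (L := L) w.1).1 h2
  -- integrality of `charpoly δ_w` in the `ValuativeRel` currency (★ `charpoly_coeff_mem_integer_of_deep`; ★ (D1)′ states it in the `Valued` currency)
  have hint : ∀ i : ℕ, (((δ.val : GL (Fin 3) (LocalRing L v)).val.map (Pi.evalRingHom (fun w' : PlacesOver L v => w'.1.adicCompletion L) w))).charpoly.coeff i ∈ 𝒪[w.1.adicCompletion L] := fun i => by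
    rw [← hcoe]
    exact charpoly_coeff_mem_integer_of_deep
      ((localNonsplitEquiv (IsCMField.complexConj L) H' hc1 w hw δ :
        ↥(unitaryGroupOfForm σ (placeForm H' w.1))) : GL (Fin 3) (w.1.adicCompletion L)) ht i
  have hJh : ((((hH'w.unit : GL (Fin 3) (w.1.adicCompletion L)) : Matrix (Fin 3) (Fin 3) (w.1.adicCompletion L))).map σ)ᵀ =
      (hH'w.unit : GL (Fin 3) (w.1.adicCompletion L)) :=
    placeForm_hermitian_of_smul_eq (IsCMField.complexConj L) w H' hH' hw
  have hτU' : (((δ.val : GL (Fin 3) (LocalRing L v)).val.map (Pi.evalRingHom (fun w' : PlacesOver L v => w'.1.adicCompletion L) w)).map σ)ᵀ * ((hH'w.unit : GL (Fin 3) (w.1.adicCompletion L)) : Matrix (Fin 3) (Fin 3) (w.1.adicCompletion L)) * ((δ.val : GL (Fin 3) (LocalRing L v)).val.map (Pi.evalRingHom (fun w' : PlacesOver L v => w'.1.adicCompletion L) w)) =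
      (hH'w.unit : GL (Fin 3) (w.1.adicCompletion L)) := by
    rw [IsUnit.unit_spec]; exact hτU
  -- the disc token and the square-distance guard in the `(t, D)` tokens
  have hdisc : Valued.v (t ^ 2 - 4 * D) = WithZero.exp (-((2 * N : ℕ) : ℤ)) := by rw [htt, hDD]; exact hN
  have htv : Valued.v ((γH.1.val : GL (Fin 2) (LocalRing L v)).val.map (Pi.evalRingHom (fun w' : PlacesOver L v => w'.1.adicCompletion L) w)).trace ≤ 1 := by rw [← htt]; exact (Valuation.mem_integer_iff _ _).1 htO
  have hDv : Valued.v ((γH.1.val : GL (Fin 2) (LocalRing L v)).val.map (Pi.evalRingHom (fun w' : PlacesOver L v => w'.1.adicCompletion L) w)).det ≤ 1 := by rw [← hDD]; exact (Valuation.mem_integer_iff _ _).1 hDO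
  obtain ⟨-, -, hsq⟩ := exists_valued_disc_eq_exp_neg_even_sqDist_of_not_exists_isRoot_ramified L v w hw he hv2 hirr htv hDv
  have hsq' : ∀ z : w.1.adicCompletion L, Valued.v (t ^ 2 - 4 * D) ≤ Valued.v (t ^ 2 - 4 * D - z ^ 2) := by
    intro z; have h := hsq z; rwa [← htt, ← hDD] at h
  -- Step 3: ★ FILE 2c
  obtain ⟨h₁, h₂⟩ := ncard_selfDual_cyclic_typeTwo_ram_eq_of_norm L w hw he hv2 hH'w.unit hH'i hJh ((δ.val : GL (Fin 3) (LocalRing L v)).val.map (Pi.evalRingHom (fun w' : PlacesOver L v => w'.1.adicCompletion L) w)) hτU' hint hχ hσu hσD hσt hu1 ht2 hn' hdisc hsq' hN1 hK hx₀ hx₀0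
  -- Step 4: the κ-form of the favourable condition (§1 + ★ (D1)′ (26′))
  -- `χ_g(u)` read at `w`
  have hχev : ((finCharpolyTwo L v γH).eval (finGammaTwo L v γH)) w = u * u - t * u + D := by
    have hfin : finCharpolyTwo L v γH = ((γH.1.val : GL (Fin 2) (LocalRing L v)).val).charpoly := rfl
    have hgcp : ((γH.1.val : GL (Fin 2) (LocalRing L v)).val.map (Pi.evalRingHom (fun w' : PlacesOver L v => w'.1.adicCompletion L) w)).charpoly = X ^ 2 - C t * X + C D := by rw [htt, hDD]; exact Matrix.charpoly_fin_two _
    show (Pi.evalRingHom (fun w' : PlacesOver L v => w'.1.adicCompletion L) w) ((finCharpolyTwo L v γH).eval (finGammaTwo L v γH)) = _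
    rw [← eval₂_at_apply, ← eval_map, hfin, ← Matrix.charpoly_map, hgcp, hu]
    simp only [eval_add, eval_sub, eval_mul, eval_X, eval_C, sq]
    rfl
  -- non-vanishing and `σ`-invariance of `c(γH)`
  have hu0 : u ≠ 0 := fun h0 => by rw [h0, mul_zero] at hσu; exact zero_ne_one hσu
  have hD0 : D ≠ 0 := fun h0 => by rw [h0, zero_mul] at hσD; exact zero_ne_one hσD
  have hσu' : σ u = u⁻¹ := eq_inv_of_mul_eq_one_left hσu
  have hσD' : σ D = D⁻¹ := eq_inv_of_mul_eq_one_right hσD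
  have h1u : 1 + u ≠ 0 := by
    intro h0
    have hu' : u = -1 := by linear_combination h0
    rw [hu', show (-1 : w.1.adicCompletion L) - 1 = -2 by ring, Valuation.map_neg, hv2] at hu1
    exact lt_irrefl _ hu1
  have htv1 : Valued.v t ≤ 1 := (Valuation.mem_integer_iff _ _).1 htO
  have hdisc1 : Valued.v (t ^ 2 - 4 * D) < 1 := by
    rw [hdisc, ← WithZero.exp_zero]; exact WithZero.exp_lt_exp.2 (by omega)
  have h4v : Valued.v (4 : w.1.adicCompletion L) = 1 := by
    rw [show (4 : w.1.adicCompletion L) = 2 * 2 by norm_num, map_mul, hv2, mul_one]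
  have hD1 : Valued.v (D - 1) < 1 := by
    have h4 : Valued.v (4 * (D - 1)) < 1 := by
      rw [show 4 * (D - 1) = (t - 2) * (t + 2) + -(t ^ 2 - 4 * D) by ring]
      refine (Valued.v.map_add _ _).trans_lt (max_lt ?_ ?_)
      · rw [map_mul]
        exact mul_lt_one_of_lt_of_le ht2 ((Valued.v.map_add _ _).trans (max_le htv1 hv2.le))
      · rw [Valuation.map_neg]; exact hdisc1
    rwa [map_mul, h4v, one_mul] at h4
  have h1tD : 1 + t + D ≠ 0 := by
    intro h0
    have h : Valued.v ((t - 2) + (D - 1)) = Valued.v (-4 : w.1.adicCompletion L) := by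
      rw [show (t - 2) + (D - 1) = (1 + t + D) - 4 by ring, h0, zero_sub]
    rw [Valuation.map_neg, h4v] at h
    have hlt : Valued.v ((t - 2) + (D - 1)) < 1 := (Valued.v.map_add _ _).trans_lt (max_lt ht2 hD1)
    rw [h] at hlt; exact lt_irrefl _ hlt
  have hdet0 : (placeForm H' w.1).det ≠ 0 := by
    have h := (Matrix.isUnit_iff_isUnit_det _).1 hH'w
    exact h.ne_zero
  have hσdet : σ (placeForm H' w.1).det = (placeForm H' w.1).det := by
    have h := congrArg Matrix.det (placeForm_hermitian_of_smul_eq (IsCMField.complexConj L) w H' hH' hw)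
    rw [Matrix.det_transpose, ← RingHom.mapMatrix_apply, ← RingHom.map_det] at h
    exact h
  set c : w.1.adicCompletion L := (placeForm H' w.1).det * (u * u - t * u + D) / ((1 + u) ^ 2 * (1 + t + D)) with hcdef
  have hc0 : c ≠ 0 := by
    rw [hcdef]
    exact div_ne_zero (mul_ne_zero hdet0 hχune) (mul_ne_zero (pow_ne_zero 2 h1u) h1tD)
  have hk0 : u * u * D ≠ 0 := mul_ne_zero (mul_ne_zero hu0 hu0) hD0
  have hσχ : σ (u * u - t * u + D) = (u * u - t * u + D) * (u * u * D)⁻¹ := by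
    rw [map_add, map_sub, map_mul, map_mul, hσu', hσt, hσD']
    field_simp
    ring
  have hσden : σ ((1 + u) ^ 2 * (1 + t + D)) = ((1 + u) ^ 2 * (1 + t + D)) * (u * u * D)⁻¹ := by
    rw [map_mul, map_pow, map_add, map_add, map_add, map_one, hσu', hσt, hσD']
    field_simp
    ring
  have hσc : σ c = c := by
    rw [hcdef, map_div₀, map_mul, hσdet, hσχ, hσden, ← mul_assoc, mul_div_mul_right _ _ (inv_ne_zero hk0)]
  -- `d₀(δ)·det J·χ_λ(u)∕((1+u)²χ_λ(−1)) = d₀(δ)·c`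
  have hprod : (∑ k : Fin 3, ∑ i : Fin 3, σ (x₀ i) * ((hH'w.unit : GL (Fin 3) (w.1.adicCompletion L)) : Matrix (Fin 3) (Fin 3) (w.1.adicCompletion L)) i k * x₀ k) *
        ((hH'w.unit : GL (Fin 3) (w.1.adicCompletion L)) : Matrix (Fin 3) (Fin 3) (w.1.adicCompletion L)).det * ((u ^ 2 - t * u + D) / ((1 + u) ^ 2 * (1 + t + D))) =
      (∑ i : Fin 3, ∑ k : Fin 3, σ (x₀ i) * placeForm H' w.1 i k * x₀ k) * c := by
    rw [IsUnit.unit_spec, Finset.sum_comm, hcdef]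
    ring
  have key : (∃ z : w.1.adicCompletion L, z * σ z *
      ((∑ k : Fin 3, ∑ i : Fin 3, σ (x₀ i) * ((hH'w.unit : GL (Fin 3) (w.1.adicCompletion L)) : Matrix (Fin 3) (Fin 3) (w.1.adicCompletion L)) i k * x₀ k) *
        ((hH'w.unit : GL (Fin 3) (w.1.adicCompletion L)) : Matrix (Fin 3) (Fin 3) (w.1.adicCompletion L)).det * ((u ^ 2 - t * u + D) / ((1 + u) ^ 2 * (1 + t + D)))) = 1) ↔
      (finKappaAt L v H' γH δ = 1 ↔ ∃ z : w.1.adicCompletion L, z * σ z * c = 1) := by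
    rw [hprod, exists_norm_mul_iff_of_nonsplit L w hw ?_ hS0 hc0 hσS hσc, h26]
    -- `|2|_v = 1` from `|2|_w = 1` and `e(w|v) = 2`
    have he2 : v.asIdeal.ramificationIdx' w.1.asIdeal = 2 :=
      Literature.NumberTheory.Automorphic.Liu2021.LemD1IndexedNonVacuityRamifiedPlace.ramificationIdx'_eq_two_of_ne_one L v (IsCMField.complexConj L) hc1 w hw he
    have h := valued_toPlace v w (2 : v.adicCompletion ↥(maximalRealSubfield L))
    rw [map_ofNat, hv2, he2] at h
    rcases eq_or_ne (Valued.v (2 : v.adicCompletion ↥(maximalRealSubfield L))) 0 with h0 | h0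
    · rw [h0, zero_pow two_ne_zero] at h; exact absurd h one_ne_zero
    · rw [← WithZero.exp_log h0, ← WithZero.exp_nsmul, ← WithZero.exp_zero, WithZero.exp_inj] at h
      rw [← WithZero.exp_log h0, ← WithZero.exp_zero, WithZero.exp_inj]
      simp only [nsmul_eq_mul, Nat.cast_ofNat] at h
      omega
  -- Step 5: conclude
  have hcst : (placeForm H' w.1).det * (((finCharpolyTwo L v γH).eval (finGammaTwo L v γH)) w) /
      ((1 + finGammaTwo L v γH w) ^ 2 * (1 + ((γH.1.val : GL (Fin 2) (LocalRing L v)).val.map (Pi.evalRingHom (fun w' : PlacesOver L v => w'.1.adicCompletion L) w)).trace + ((γH.1.val : GL (Fin 2) (LocalRing L v)).val.map (Pi.evalRingHom (fun w' : PlacesOver L v => w'.1.adicCompletion L) w)).det)) = c := by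
    rw [hχev, ← hu, ← htt, ← hDD]
  rw [hcst]
  by_cases hF : (finKappaAt L v H' γH δ = 1 ↔ ∃ z : w.1.adicCompletion L, z * σ z * c = 1)
  · rw [if_pos hF]; exact h₁ (key.2 hF)
  · rw [if_neg hF]; exact h₂ (fun h => hF (key.1 h))

end Literature.NumberTheory.Rogawski1990

end
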